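import Literature.MathematicalPhysics.QuantumLattice.HubbardNNNHoppingFluxStiffnessSecondOrder
import Literature.MathematicalPhysics.QuantumLattice.FreeFermiGasNoPairFieldLRO
import HarnessLib

/-!
# Trial-operator (commutator) and odd-moment forms of the second-order stiffness ceiling, `t–t'` torus, `T = 0`

Topic `Literature/MathematicalPhysics/QuantumLattice` (family `hubbard`); companion of
`HubbardNNNHoppingFluxStiffnessSecondOrder.lean`, whose second-order Rayleigh (Kohn / Hylleraas)
inequality `stiffnessTT'_mul_sq_le_of_isGroundStateInSector`
(`ρ L² ≤ ½Re⟨ψ,𝒦ψ⟩ + 2λ Re⟨ψ,𝒥η⟩ + λ²(Re⟨η,Hη⟩ − E₀‖η‖²)` for every sector vector `η`) is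
specialised here to trial directions GENERATED BY OPERATORS, so that every term becomes the
ground-state expectation of ONE fixed operator polynomial. Everything here is PROVED; no named facts.

* **Trial-operator (commutator) form** (`stiffnessTT'_mul_sq_le_of_hermitian_generator`): for every
  Hermitian `C` with `Cψ` in the sector and every real `μ`, the direction `η = iCψ` gives
  `ρ L² ≤ ½Re⟨ψ,𝒦ψ⟩ + μ Re⟨ψ, i[𝒥,C] ψ⟩ + (μ²/2) Re⟨ψ, [C,[H,C]] ψ⟩`
  (numerator `2Re⟨ψ,𝒥(iC)ψ⟩ = Re⟨ψ,i[𝒥,C]ψ⟩` because `iC` is anti-Hermitian; denominator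
  `Re⟨Cψ,(H−E₀)Cψ⟩ = ½Re⟨ψ,[C,[H,C]]ψ⟩` for an eigenvector). This is the `T = 0` case of the thermal
  trial-operator (sharp Bogoliubov) ceiling of the programme `pub-hubbard` (`bounds.tex` Thm 6_T♯,
  `ThermalTrialOperatorStiffnessCeilingTT'`), i.e. the Pitaevskii–Stringari uncertainty-type
  inequality `m₋₁(𝒥) · ⟨[C,[H,C]]⟩ ≥ ½|⟨[𝒥,C]⟩|²` (Cauchy–Schwarz between the mixed moment
  `m₀⁻(𝒥,C) = ½⟨[𝒥,C]⟩` of Lipparini (2008) eq. (8.39) and `m₋₁(𝒥)`, `m₁(C)` of eqs. (8.30), (8.33))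
  realised variationally. WHY IT MATTERS: when
  `C = Σ_x τ_x(c)` is a translation sum of a LOCAL polynomial `c`, both `i[𝒥,C]` and `[C,[H,C]]` are
  translation sums of local polynomials (commutators of local sums are local sums), so for every fixed
  `(c, μ)` the right-hand side is a LINEAR functional of finitely many local ground-state
  expectations per site — an objective for the thermodynamic-limit moment relaxations under an energy
  window, strictly sharper than the f-sum (kinetic-energy) ceiling whenever `⟨i[𝒥,C]⟩ ≠ 0`.
  Optimal `μ` (`stiffnessTT'_mul_sq_le_kinetic_sub_commutator_sq_div`): `ρ L² ≤ K − g²/(2c)`; certified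
  form (`stiffnessTT'_mul_sq_le_of_certified_commutator`): `K ≤ K_hi`, `|g| ≥ g_lo ≥ 0`, `c ≤ c_hi`,
  `c_hi > 0` give `ρ L² ≤ K_hi − g_lo²/(2 c_hi)`.
* **Odd-moment (Krylov) form** (`stiffnessTT'_mul_sq_le_kinetic_sub_firstMoment_sq_div_thirdMoment`):
  the direction `η = [H,𝒥]ψ = (H − E₀)𝒥ψ` gives `ρ L² ≤ K − m₁²/m₃`, `m₁ = Re⟨𝒥ψ,(H−E₀)𝒥ψ⟩`,
  `m₃ = Re⟨[H,𝒥]ψ,(H−E₀)[H,𝒥]ψ⟩` — the moment inequality `m₋₁ ≥ m₁²/m₃` (log-convexity of the moments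
  of the current strength function, i.e. `E₁ = √(m₁/m₋₁) ≤ E₃ = √(m₃/m₁)`; Bohigas–Lane–Martorell 1979,
  Lipparini 2008 p. 431) applied to Kohn's second-order term.
  Unlike `m₀ = ‖𝒥ψ‖²` (a `q = 0` structure factor), `m₁ = ½⟨[𝒥,[H,𝒥]]⟩`
  (`curOpTT'_firstMoment_eq_re_doubleCommutator`) and `m₃ = ½⟨[[H,𝒥],[[H,𝒥],H]]⟩`
  (`curOpTT'_thirdMoment_eq_re_doubleCommutator`) are expectations of translation sums of LOCAL
  polynomials. Certified form (`stiffnessTT'_mul_sq_le_of_certified_odd_moments`):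
  `K ≤ K_hi`, `m₁ ≥ M1_lo ≥ 0`, `m₃ ≤ M3_hi`, `M3_hi > 0` give `ρ L² ≤ K_hi − M1_lo²/M3_hi`.

References: W. Kohn, Phys. Rev. 133 (1964) A171 [Kohn1964]; D. J. Scalapino, S. R. White,
S. C. Zhang, PRB 47 (1993) 7995, §II [ScalapinoWhiteZhang1993]; O. Bohigas, A. M. Lane,
J. Martorell, Phys. Rep. 51 (1979) 267 [BohigasLaneMartorell1979]; E. Lipparini, Modern
Many-Particle Physics (2008), eqs. (8.30)–(8.33), (8.37)–(8.39), (10.64), p. 431 [Lipparini2008]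
[corpus: book:lipparini2008-modern-many-particle-physics-atomic-gases-nanostructures pp. 319–320, 431, 464]; L. Pitaevskii,
S. Stringari, J. Low Temp. Phys. 85 (1991) 377 [PitaevskiiStringari1991]; programme pub-hubbard
`bounds.tex` Thms 5♯, 6, 6_T♯ (Summits/HubbardSuperconductivity/HubbardLadder/Bounds/
StiffnessCeilingTrialDirection.lean, ThermalTrialOperatorStiffnessCeiling.lean).
-/

noncomputable section

namespace Literature.MathematicalPhysics.QuantumLattice

open Matrix Finset Literature.MathematicalPhysics.QuantumFieldTheory
  Literature.Probability.LatticeModels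

open scoped ComplexConjugate ComplexOrder

variable {L : ℕ} [NeZero L]

/-! ### Generic quadratic-form identities -/

section Generic

variable {n : Type*} [Fintype n] [DecidableEq n]

omit [DecidableEq n] in
/-- For a Hermitian `M`: `⟨ψ, M v⟩ = ⟨Mψ, v⟩`. [folklore] -/
private theorem star_dotProduct_herm_mulVec {M : Matrix n n ℂ} (hM : M.IsHermitian)
    (ψ v : n → ℂ) : star ψ ⬝ᵥ (M *ᵥ v) = star (M *ᵥ ψ) ⬝ᵥ v := by
  rw [star_mulVec, hM.eq, ← dotProduct_mulVec]

omit [DecidableEq n] in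
/-- For Hermitian `J`, `C`: `⟨ψ, C(Jψ)⟩ = conj ⟨ψ, J(Cψ)⟩`. [folklore] -/
private theorem star_dotProduct_herm_herm_swap {J C : Matrix n n ℂ} (hJ : J.IsHermitian)
    (hC : C.IsHermitian) (ψ : n → ℂ) :
    star ψ ⬝ᵥ (C *ᵥ (J *ᵥ ψ)) = (starRingEnd ℂ) (star ψ ⬝ᵥ (J *ᵥ (C *ᵥ ψ))) := by
  rw [star_dotProduct_herm_mulVec hC, star_dotProduct_herm_mulVec hJ, star_dotProduct,
    Complex.star_def]

omit [DecidableEq n] in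
/-- **The numerator of an anti-Hermitian trial direction is a commutator**: for Hermitian `J`, `C`
and every `ψ`, `2 Re⟨ψ, J((iC)ψ)⟩ = Re⟨ψ, (i(JC − CJ))ψ⟩`. [folklore] -/
private theorem two_mul_re_star_dotProduct_mulVec_smul_I_mulVec {J C : Matrix n n ℂ} (hJ : J.IsHermitian)
    (hC : C.IsHermitian) (ψ : n → ℂ) :
    2 * (star ψ ⬝ᵥ (J *ᵥ ((Complex.I • C) *ᵥ ψ))).re =
      (star ψ ⬝ᵥ ((Complex.I • (J * C - C * J)) *ᵥ ψ)).re := by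
  have hsw := star_dotProduct_herm_herm_swap hJ hC ψ
  rw [smul_mulVec, mulVec_smul, dotProduct_smul, smul_mulVec, dotProduct_smul,
    sub_mulVec, ← mulVec_mulVec, ← mulVec_mulVec, dotProduct_sub, hsw]
  simp only [smul_eq_mul, Complex.mul_re, Complex.I_re, Complex.I_im, Complex.sub_re,
    Complex.sub_im, Complex.conj_re, Complex.conj_im]
  ring

omit [DecidableEq n] in
/-- The trial direction `iCψ` has the same norm and the same quadratic forms as `Cψ`:
`⟨(iC)ψ, M (iC)ψ⟩ = ⟨Cψ, M Cψ⟩`. [folklore] -/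
private theorem star_smul_I_mulVec_dotProduct_mulVec (M C : Matrix n n ℂ) (ψ : n → ℂ) :
    star ((Complex.I • C) *ᵥ ψ) ⬝ᵥ (M *ᵥ ((Complex.I • C) *ᵥ ψ)) =
      star (C *ᵥ ψ) ⬝ᵥ (M *ᵥ (C *ᵥ ψ)) := by
  rw [smul_mulVec, star_smul, mulVec_smul, smul_dotProduct, dotProduct_smul, Complex.star_def,
    Complex.conj_I, smul_eq_mul, smul_eq_mul, ← mul_assoc, neg_mul, Complex.I_mul_I, neg_neg, one_mul]

/-- `‖(iC)ψ‖² = ‖Cψ‖²`. [folklore] -/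
private theorem star_smul_I_mulVec_dotProduct_self (C : Matrix n n ℂ) (ψ : n → ℂ) :
    star ((Complex.I • C) *ᵥ ψ) ⬝ᵥ ((Complex.I • C) *ᵥ ψ) = star (C *ᵥ ψ) ⬝ᵥ (C *ᵥ ψ) := by
  have h := star_smul_I_mulVec_dotProduct_mulVec (1 : Matrix n n ℂ) C ψ
  simpa only [Matrix.one_mulVec] using h

omit [DecidableEq n] in
/-- For an eigenvector `Hψ = Eψ` (`H`, `J` Hermitian): `⟨ψ, J((HJ − JH)ψ)⟩ = ⟨Jψ, H Jψ⟩ − E‖Jψ‖²` —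
the first Krylov direction `[H,J]ψ = (H − E)Jψ` has overlap `m₁` with `Jψ`. [cite: Lipparini2008, eq. (8.30)] -/
theorem star_dotProduct_mulVec_commutator_mulVec {H J : Matrix n n ℂ}
    (hJ : J.IsHermitian) {ψ : n → ℂ} {E : ℝ} (hψ : H *ᵥ ψ = (E : ℂ) • ψ) :
    star ψ ⬝ᵥ (J *ᵥ ((H * J - J * H) *ᵥ ψ)) =
      star (J *ᵥ ψ) ⬝ᵥ (H *ᵥ (J *ᵥ ψ)) - (E : ℂ) * (star (J *ᵥ ψ) ⬝ᵥ (J *ᵥ ψ)) := by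
  rw [sub_mulVec, ← mulVec_mulVec, ← mulVec_mulVec, hψ, mulVec_smul, mulVec_sub, mulVec_smul,
    dotProduct_sub, dotProduct_smul, star_dotProduct_herm_mulVec hJ ψ (H *ᵥ (J *ᵥ ψ)),
    star_dotProduct_herm_mulVec hJ ψ (J *ᵥ ψ), smul_eq_mul]

omit [DecidableEq n] in
/-- **Double commutator for an ANTI-Hermitian generator**: for Hermitian `H`, `Bᴴ = −B` and an
eigenvector `Hψ = Eψ`, `⟨ψ, (B[H,B] − [H,B]B) ψ⟩ = −2⟨Bψ, H Bψ⟩ + 2E ‖Bψ‖²`, i.e.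
`Re⟨Bψ,(H − E)Bψ⟩ = ½⟨ψ,[[H,B],B]ψ⟩` — the Hylleraas denominator of the direction `Bψ` is the
expectation of a fixed operator polynomial. [cite: Lipparini2008, eq. (8.30)] -/
theorem star_dotProduct_doubleCommutator_mulVec_of_conjTranspose_eq_neg {H B : Matrix n n ℂ}
    (hH : H.IsHermitian) (hB : Bᴴ = -B) {ψ : n → ℂ} {E : ℝ} (hψ : H *ᵥ ψ = (E : ℂ) • ψ) :
    star ψ ⬝ᵥ ((B * (H * B - B * H) - (H * B - B * H) * B) *ᵥ ψ) =
      -(2 * (star (B *ᵥ ψ) ⬝ᵥ (H *ᵥ (B *ᵥ ψ)))) + 2 * (E : ℂ) * (star (B *ᵥ ψ) ⬝ᵥ (B *ᵥ ψ)) := by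
  have hBv : ∀ v : n → ℂ, star ψ ⬝ᵥ (B *ᵥ v) = -(star (B *ᵥ ψ) ⬝ᵥ v) := fun v => by
    rw [star_mulVec, hB, vecMul_neg, neg_dotProduct, ← dotProduct_mulVec, neg_neg]
  have hHv : ∀ v : n → ℂ, star ψ ⬝ᵥ (H *ᵥ v) = (E : ℂ) * (star ψ ⬝ᵥ v) := fun v => by
    calc star ψ ⬝ᵥ (H *ᵥ v) = star (H *ᵥ ψ) ⬝ᵥ v := by
          rw [star_mulVec, hH.eq, ← dotProduct_mulVec]
      _ = (E : ℂ) * (star ψ ⬝ᵥ v) := by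
          rw [hψ, star_smul, smul_dotProduct, Complex.star_def, Complex.conj_ofReal, smul_eq_mul]
  simp only [sub_mulVec, ← mulVec_mulVec, mulVec_sub, hψ, mulVec_smul, dotProduct_sub,
    dotProduct_smul, smul_eq_mul]
  simp only [hHv, hBv]
  ring

omit [DecidableEq n] in
/-- The commutator of two Hermitian matrices is anti-Hermitian: `(HJ − JH)ᴴ = −(HJ − JH)`. [folklore] -/
private theorem conjTranspose_commutator_of_isHermitian {H J : Matrix n n ℂ} (hH : H.IsHermitian)
    (hJ : J.IsHermitian) : (H * J - J * H)ᴴ = -(H * J - J * H) := by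
  rw [conjTranspose_sub, conjTranspose_mul, conjTranspose_mul, hH.eq, hJ.eq, neg_sub]

end Generic

/-! ### The trial-operator (commutator) form -/

omit [NeZero L] in
/-- The `t–t'` Hamiltonian maps every joint sector `(N, S^z = M)` into itself (it conserves `N` and
`S^z`). [cite: LiebPRL1989, Remark (2)] -/
theorem hubbardTorusTT'_mulVec_mem_szSector (t t' U : ℝ) {N : ℕ} {M : ℝ}
    {v : Fock (Orb (FermionTorus 2 L))} (hv : v ∈ szSector N M) :
    hubbardTorusTT' L t t' U *ᵥ v ∈ szSector N M :=
  mulVec_mem_szSector_of_commute (hubbardTorusTT'_commute_totalNumber L t t' U)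
    (hubbardTorusTT'_commute_spinZ L t t' U) hv

/-- **Trial-operator (commutator) form of the second-order stiffness ceiling, `t–t'` torus, `T = 0`**
(`L ≥ 3`): if `E^{tt'}_L(θ) − E^{tt'}_L(0) ≥ ρ θ²` for `|θ| ≤ θ₀` (`θ₀ > 0`), then for every zero-flux
`(N_L, 0)`-sector ground state `ψ` (unit vector), every Hermitian `C` with `Cψ` in the sector and every
real `μ`:
`ρ L² ≤ ½ Re⟨ψ, 𝒦 ψ⟩ + μ Re⟨ψ, i(𝒥C − C𝒥) ψ⟩ + (μ²/2) Re⟨ψ, (C(HC − CH) − (HC − CH)C) ψ⟩`,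
`𝒦 = kinOpTT'`, `𝒥 = curOpTT'`, `H = hubbardTorusTT' L 1 t' U` — the direction `η = iCψ` in
`stiffnessTT'_mul_sq_le_of_isGroundStateInSector`: the numerator is a commutator because `iC` is
anti-Hermitian, the denominator a double commutator because `ψ` is an eigenvector. For `C` a
translation sum of a local polynomial all three operators are translation sums of local polynomials
(an SDP objective of the thermodynamic-limit relaxations for each fixed `μ`); the `T > 0` analogue is
pub-hubbard's `ThermalTrialOperatorStiffnessCeilingTT'`. [cite: Lipparini2008, eq. (8.39)] -/
theorem stiffnessTT'_mul_sq_le_of_hermitian_generator (hL : 3 ≤ L) (t' U δ : ℝ)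
    {ρs θ₀ : ℝ} (hθ₀ : 0 < θ₀)
    (hstiff : ∀ θ : ℝ, |θ| ≤ θ₀ →
      ρs * θ ^ 2 ≤ fluxEnergyTT' L t' U δ θ - fluxEnergyTT' L t' U δ 0)
    {ψ : Fock (Orb (FermionTorus 2 L))}
    (hgs : IsGroundStateInSector (hubbardTorusTT' L 1 t' U) (2 * ⌊(1 - δ) * (L : ℝ) ^ 2 / 2⌋₊) 0 ψ)
    (h1 : star ψ ⬝ᵥ ψ = 1)
    {C : Matrix (Finset (Orb (FermionTorus 2 L))) (Finset (Orb (FermionTorus 2 L))) ℂ}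
    (hC : C.IsHermitian) (hCψ : C *ᵥ ψ ∈ szSector (2 * ⌊(1 - δ) * (L : ℝ) ^ 2 / 2⌋₊) 0) (μ : ℝ) :
    ρs * (L : ℝ) ^ 2 ≤
      (star ψ ⬝ᵥ (kinOpTT' L t' *ᵥ ψ)).re / 2 +
        μ * (star ψ ⬝ᵥ ((Complex.I • (curOpTT' L t' * C - C * curOpTT' L t')) *ᵥ ψ)).re +
        μ ^ 2 / 2 * (star ψ ⬝ᵥ ((C * (hubbardTorusTT' L 1 t' U * C - C * hubbardTorusTT' L 1 t' U) -
          (hubbardTorusTT' L 1 t' U * C - C * hubbardTorusTT' L 1 t' U) * C) *ᵥ ψ)).re := by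
  set H := hubbardTorusTT' L 1 t' U with hHdef
  set J := curOpTT' L t' with hJdef
  have hη : (Complex.I • C) *ᵥ ψ ∈ szSector (2 * ⌊(1 - δ) * (L : ℝ) ^ 2 / 2⌋₊) 0 := by
    rw [smul_mulVec]
    exact Submodule.smul_mem _ _ hCψ
  have h := stiffnessTT'_mul_sq_le_of_isGroundStateInSector hL t' U δ hθ₀ hstiff hgs h1 hη μ
  have hnum : 2 * μ * (star ψ ⬝ᵥ (J *ᵥ ((Complex.I • C) *ᵥ ψ))).re =
      μ * (star ψ ⬝ᵥ ((Complex.I • (J * C - C * J)) *ᵥ ψ)).re := by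
    rw [← two_mul_re_star_dotProduct_mulVec_smul_I_mulVec (isHermitian_curOpTT' (L := L) t') hC ψ]
    ring
  have hE : H *ᵥ ψ = ((fluxEnergyTT' L t' U δ 0 : ℝ) : ℂ) • ψ := by
    rw [fluxEnergyTT'_eq, hubbardTorusTT'Flux_zero]
    exact hgs.2.2
  have hdc := star_dotProduct_doubleCommutator_mulVec (hubbardTorusTT'_isHermitian L 1 t' U) hC hE
  have hreal : (star (C *ᵥ ψ) ⬝ᵥ (C *ᵥ ψ)).im = 0 := by
    rw [RayleighBottom.star_dotProduct_self_eq_sum, Complex.ofReal_im]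
  have hden : (star ((Complex.I • C) *ᵥ ψ) ⬝ᵥ (H *ᵥ ((Complex.I • C) *ᵥ ψ))).re -
      fluxEnergyTT' L t' U δ 0 * (star ((Complex.I • C) *ᵥ ψ) ⬝ᵥ ((Complex.I • C) *ᵥ ψ)).re =
      (star ψ ⬝ᵥ ((C * (H * C - C * H) - (H * C - C * H) * C) *ᵥ ψ)).re / 2 := by
    rw [star_smul_I_mulVec_dotProduct_mulVec, star_smul_I_mulVec_dotProduct_self, hdc]
    simp only [Complex.sub_re, Complex.mul_re, Complex.re_ofNat, Complex.im_ofNat, Complex.ofReal_re,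
      Complex.ofReal_im, hreal, zero_mul, sub_zero, mul_zero]
    ring
  have hsq : μ ^ 2 * ((star ((Complex.I • C) *ᵥ ψ) ⬝ᵥ (H *ᵥ ((Complex.I • C) *ᵥ ψ))).re -
      fluxEnergyTT' L t' U δ 0 * (star ((Complex.I • C) *ᵥ ψ) ⬝ᵥ ((Complex.I • C) *ᵥ ψ)).re) =
      μ ^ 2 / 2 * (star ψ ⬝ᵥ ((C * (H * C - C * H) - (H * C - C * H) * C) *ᵥ ψ)).re := by
    rw [hden]
    ring
  linarith [h, hnum, hsq]

omit [NeZero L] in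
/-- The double-commutator coefficient is nonnegative for a sector ground state:
`Re⟨ψ, (C(HC − CH) − (HC − CH)C) ψ⟩ = 2 Re⟨Cψ,(H − E₀)Cψ⟩ ≥ 0` by the variational principle in the
sector (`Cψ` is a sector vector). [cite: Lipparini2008, eq. (8.30)] -/
theorem re_star_dotProduct_doubleCommutator_mulVec_nonneg (t' U : ℝ) {N : ℕ} {M : ℝ}
    {ψ : Fock (Orb (FermionTorus 2 L))} (hgs : IsGroundStateInSector (hubbardTorusTT' L 1 t' U) N M ψ)
    {C : Matrix (Finset (Orb (FermionTorus 2 L))) (Finset (Orb (FermionTorus 2 L))) ℂ}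
    (hC : C.IsHermitian) (hCψ : C *ᵥ ψ ∈ szSector N M) :
    0 ≤ (star ψ ⬝ᵥ ((C * (hubbardTorusTT' L 1 t' U * C - C * hubbardTorusTT' L 1 t' U) -
      (hubbardTorusTT' L 1 t' U * C - C * hubbardTorusTT' L 1 t' U) * C) *ᵥ ψ)).re := by
  set H := hubbardTorusTT' L 1 t' U with hHdef
  have hdc := star_dotProduct_doubleCommutator_mulVec (hubbardTorusTT'_isHermitian L 1 t' U) hC hgs.2.2
  have hvar := minEnergyOn_mul_re_star_dotProduct_self_le (hubbardTorusTT'_isHermitian L 1 t' U)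
    (szSector N M) hCψ
  have hreal : (star (C *ᵥ ψ) ⬝ᵥ (C *ᵥ ψ)).im = 0 := by
    rw [RayleighBottom.star_dotProduct_self_eq_sum, Complex.ofReal_im]
  rw [hdc]
  simp only [Complex.sub_re, Complex.mul_re, Complex.re_ofNat, Complex.im_ofNat, Complex.ofReal_re,
    Complex.ofReal_im, hreal, zero_mul, sub_zero, mul_zero]
  linarith

/-- **Optimal generator scaling**: with `g = Re⟨ψ, i(𝒥C − C𝒥) ψ⟩` and
`c = Re⟨ψ, (C(HC − CH) − (HC − CH)C) ψ⟩ > 0`, `ρ L² ≤ ½ Re⟨ψ, 𝒦 ψ⟩ − g²/(2c)` (`μ = −g/c` in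
`stiffnessTT'_mul_sq_le_of_hermitian_generator`): Kohn's paramagnetic term is minorised by the
uncertainty-type bound `m₋₁(𝒥) ≥ |⟨[𝒥,C]⟩|²/(2⟨[C,[H,C]]⟩)`. [cite: Lipparini2008, eq. (8.39)] -/
theorem stiffnessTT'_mul_sq_le_kinetic_sub_commutator_sq_div (hL : 3 ≤ L) (t' U δ : ℝ)
    {ρs θ₀ : ℝ} (hθ₀ : 0 < θ₀)
    (hstiff : ∀ θ : ℝ, |θ| ≤ θ₀ →
      ρs * θ ^ 2 ≤ fluxEnergyTT' L t' U δ θ - fluxEnergyTT' L t' U δ 0)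
    {ψ : Fock (Orb (FermionTorus 2 L))}
    (hgs : IsGroundStateInSector (hubbardTorusTT' L 1 t' U) (2 * ⌊(1 - δ) * (L : ℝ) ^ 2 / 2⌋₊) 0 ψ)
    (h1 : star ψ ⬝ᵥ ψ = 1)
    {C : Matrix (Finset (Orb (FermionTorus 2 L))) (Finset (Orb (FermionTorus 2 L))) ℂ}
    (hC : C.IsHermitian) (hCψ : C *ᵥ ψ ∈ szSector (2 * ⌊(1 - δ) * (L : ℝ) ^ 2 / 2⌋₊) 0)
    (hc : 0 < (star ψ ⬝ᵥ ((C * (hubbardTorusTT' L 1 t' U * C - C * hubbardTorusTT' L 1 t' U) -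
      (hubbardTorusTT' L 1 t' U * C - C * hubbardTorusTT' L 1 t' U) * C) *ᵥ ψ)).re) :
    ρs * (L : ℝ) ^ 2 ≤
      (star ψ ⬝ᵥ (kinOpTT' L t' *ᵥ ψ)).re / 2 -
        (star ψ ⬝ᵥ ((Complex.I • (curOpTT' L t' * C - C * curOpTT' L t')) *ᵥ ψ)).re ^ 2 /
          (2 * (star ψ ⬝ᵥ ((C * (hubbardTorusTT' L 1 t' U * C - C * hubbardTorusTT' L 1 t' U) -
            (hubbardTorusTT' L 1 t' U * C - C * hubbardTorusTT' L 1 t' U) * C) *ᵥ ψ)).re) := by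
  set g := (star ψ ⬝ᵥ ((Complex.I • (curOpTT' L t' * C - C * curOpTT' L t')) *ᵥ ψ)).re with hg
  set c := (star ψ ⬝ᵥ ((C * (hubbardTorusTT' L 1 t' U * C - C * hubbardTorusTT' L 1 t' U) -
      (hubbardTorusTT' L 1 t' U * C - C * hubbardTorusTT' L 1 t' U) * C) *ᵥ ψ)).re with hcdef
  have h := stiffnessTT'_mul_sq_le_of_hermitian_generator hL t' U δ hθ₀ hstiff hgs h1 hC hCψ (-g / c)
  rw [← hg, ← hcdef] at h
  have e : -g / c * g + (-g / c) ^ 2 / 2 * c = -(g ^ 2 / (2 * c)) := by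
    field_simp
    ring
  linarith

/-- **Certified-row form of the trial-operator ceiling**: certified bounds `½Re⟨ψ,𝒦ψ⟩ ≤ K_hi`,
`|g| ≥ g_lo ≥ 0` (`g = Re⟨ψ, i(𝒥C − C𝒥) ψ⟩`), `c ≤ c_hi` (`c` the double-commutator expectation) with
`c_hi > 0` give `ρ L² ≤ K_hi − g_lo²/(2 c_hi)` (`μ = ∓ g_lo/c_hi` according to the sign of `g`). Three
linear certificates of the window-SDP type feed it. [cite: Lipparini2008, eq. (8.39)] -/
theorem stiffnessTT'_mul_sq_le_of_certified_commutator (hL : 3 ≤ L) (t' U δ : ℝ)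
    {ρs θ₀ : ℝ} (hθ₀ : 0 < θ₀)
    (hstiff : ∀ θ : ℝ, |θ| ≤ θ₀ →
      ρs * θ ^ 2 ≤ fluxEnergyTT' L t' U δ θ - fluxEnergyTT' L t' U δ 0)
    {ψ : Fock (Orb (FermionTorus 2 L))}
    (hgs : IsGroundStateInSector (hubbardTorusTT' L 1 t' U) (2 * ⌊(1 - δ) * (L : ℝ) ^ 2 / 2⌋₊) 0 ψ)
    (h1 : star ψ ⬝ᵥ ψ = 1)
    {C : Matrix (Finset (Orb (FermionTorus 2 L))) (Finset (Orb (FermionTorus 2 L))) ℂ}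
    (hC : C.IsHermitian) (hCψ : C *ᵥ ψ ∈ szSector (2 * ⌊(1 - δ) * (L : ℝ) ^ 2 / 2⌋₊) 0)
    {Khi glo chi : ℝ} (hK : (star ψ ⬝ᵥ (kinOpTT' L t' *ᵥ ψ)).re / 2 ≤ Khi)
    (hg : glo ≤ |(star ψ ⬝ᵥ ((Complex.I • (curOpTT' L t' * C - C * curOpTT' L t')) *ᵥ ψ)).re|)
    (hglo : 0 ≤ glo)
    (hcle : (star ψ ⬝ᵥ ((C * (hubbardTorusTT' L 1 t' U * C - C * hubbardTorusTT' L 1 t' U) -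
      (hubbardTorusTT' L 1 t' U * C - C * hubbardTorusTT' L 1 t' U) * C) *ᵥ ψ)).re ≤ chi)
    (hchi : 0 < chi) :
    ρs * (L : ℝ) ^ 2 ≤ Khi - glo ^ 2 / (2 * chi) := by
  set g := (star ψ ⬝ᵥ ((Complex.I • (curOpTT' L t' * C - C * curOpTT' L t')) *ᵥ ψ)).re with hgdef
  set c := (star ψ ⬝ᵥ ((C * (hubbardTorusTT' L 1 t' U * C - C * hubbardTorusTT' L 1 t' U) -
      (hubbardTorusTT' L 1 t' U * C - C * hubbardTorusTT' L 1 t' U) * C) *ᵥ ψ)).re with hcdef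
  have hq : 0 ≤ glo / chi := div_nonneg hglo hchi.le
  have e : (glo / chi) ^ 2 / 2 * chi = glo ^ 2 / (2 * chi) := by
    field_simp
  rcases le_total 0 g with hg0 | hg0
  · rw [abs_of_nonneg hg0] at hg
    have h := stiffnessTT'_mul_sq_le_of_hermitian_generator hL t' U δ hθ₀ hstiff hgs h1 hC hCψ
      (-(glo / chi))
    rw [← hgdef, ← hcdef] at h
    have hA : -(glo / chi) * g ≤ -(glo / chi) * glo := mul_le_mul_of_nonpos_left hg (by linarith)
    have hB : (-(glo / chi)) ^ 2 / 2 * c ≤ (-(glo / chi)) ^ 2 / 2 * chi :=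
      mul_le_mul_of_nonneg_left hcle (by positivity)
    have e' : -(glo / chi) * glo + (-(glo / chi)) ^ 2 / 2 * chi = -(glo ^ 2 / (2 * chi)) := by
      field_simp
      ring
    linarith
  · rw [abs_of_nonpos hg0] at hg
    have h := stiffnessTT'_mul_sq_le_of_hermitian_generator hL t' U δ hθ₀ hstiff hgs h1 hC hCψ
      (glo / chi)
    rw [← hgdef, ← hcdef] at h
    have hA : glo / chi * g ≤ glo / chi * (-glo) := mul_le_mul_of_nonneg_left (by linarith) hq
    have hB : (glo / chi) ^ 2 / 2 * c ≤ (glo / chi) ^ 2 / 2 * chi :=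
      mul_le_mul_of_nonneg_left hcle (by positivity)
    have e' : glo / chi * (-glo) + (glo / chi) ^ 2 / 2 * chi = -(glo ^ 2 / (2 * chi)) := by
      field_simp
      ring
    linarith

/-! ### The odd-moment (Krylov) form -/

/-- **Odd-moment (Krylov) form of the second-order stiffness ceiling** (`L ≥ 3`): if
`E^{tt'}_L(θ) − E^{tt'}_L(0) ≥ ρ θ²` for `|θ| ≤ θ₀`, then for every zero-flux `(N_L, 0)`-sector ground
state `ψ` (unit vector), with `m₁ = Re⟨𝒥ψ, H𝒥ψ⟩ − E₀‖𝒥ψ‖²`, `B = H𝒥 − 𝒥H` and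
`m₃ = Re⟨Bψ, HBψ⟩ − E₀‖Bψ‖² > 0`: `ρ L² ≤ ½ Re⟨ψ, 𝒦 ψ⟩ − m₁²/m₃` — the direction `η = Bψ = (H − E₀)𝒥ψ`,
`λ = −m₁/m₃` in `stiffnessTT'_mul_sq_le_of_isGroundStateInSector` (the log-convexity inequality
`m₋₁ m₃ ≥ m₁²` of the moments of the current strength function applied to Kohn's term; weaker than
`m₀²/m₁` but built from ODD moments only, which are expectations of translation sums of local
polynomials, `curOpTT'_firstMoment_eq_re_doubleCommutator` and
`curOpTT'_thirdMoment_eq_re_doubleCommutator`; on the torus `B = U[D̂,𝒥]`, `D̂ = Σ_x n_{x↑}n_{x↓}`,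
since the hopping part commutes with `𝒥`). [cite: Lipparini2008, eq. (8.30)] -/
theorem stiffnessTT'_mul_sq_le_kinetic_sub_firstMoment_sq_div_thirdMoment (hL : 3 ≤ L) (t' U δ : ℝ)
    {ρs θ₀ : ℝ} (hθ₀ : 0 < θ₀)
    (hstiff : ∀ θ : ℝ, |θ| ≤ θ₀ →
      ρs * θ ^ 2 ≤ fluxEnergyTT' L t' U δ θ - fluxEnergyTT' L t' U δ 0)
    {ψ : Fock (Orb (FermionTorus 2 L))}
    (hgs : IsGroundStateInSector (hubbardTorusTT' L 1 t' U) (2 * ⌊(1 - δ) * (L : ℝ) ^ 2 / 2⌋₊) 0 ψ)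
    (h1 : star ψ ⬝ᵥ ψ = 1)
    (hm3 : 0 < (star ((hubbardTorusTT' L 1 t' U * curOpTT' L t' - curOpTT' L t' * hubbardTorusTT' L 1 t' U) *ᵥ ψ) ⬝ᵥ
        (hubbardTorusTT' L 1 t' U *ᵥ
          ((hubbardTorusTT' L 1 t' U * curOpTT' L t' - curOpTT' L t' * hubbardTorusTT' L 1 t' U) *ᵥ ψ))).re -
      fluxEnergyTT' L t' U δ 0 *
        (star ((hubbardTorusTT' L 1 t' U * curOpTT' L t' - curOpTT' L t' * hubbardTorusTT' L 1 t' U) *ᵥ ψ) ⬝ᵥ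
          ((hubbardTorusTT' L 1 t' U * curOpTT' L t' - curOpTT' L t' * hubbardTorusTT' L 1 t' U) *ᵥ ψ)).re) :
    ρs * (L : ℝ) ^ 2 ≤
      (star ψ ⬝ᵥ (kinOpTT' L t' *ᵥ ψ)).re / 2 -
        ((star (curOpTT' L t' *ᵥ ψ) ⬝ᵥ (hubbardTorusTT' L 1 t' U *ᵥ (curOpTT' L t' *ᵥ ψ))).re -
            fluxEnergyTT' L t' U δ 0 * (star (curOpTT' L t' *ᵥ ψ) ⬝ᵥ (curOpTT' L t' *ᵥ ψ)).re) ^ 2 /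
          ((star ((hubbardTorusTT' L 1 t' U * curOpTT' L t' - curOpTT' L t' * hubbardTorusTT' L 1 t' U) *ᵥ ψ) ⬝ᵥ
              (hubbardTorusTT' L 1 t' U *ᵥ
                ((hubbardTorusTT' L 1 t' U * curOpTT' L t' - curOpTT' L t' * hubbardTorusTT' L 1 t' U) *ᵥ ψ))).re -
            fluxEnergyTT' L t' U δ 0 *
              (star ((hubbardTorusTT' L 1 t' U * curOpTT' L t' - curOpTT' L t' * hubbardTorusTT' L 1 t' U) *ᵥ ψ) ⬝ᵥ
                ((hubbardTorusTT' L 1 t' U * curOpTT' L t' - curOpTT' L t' * hubbardTorusTT' L 1 t' U) *ᵥ ψ)).re) := by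
  set m₁ := (star (curOpTT' L t' *ᵥ ψ) ⬝ᵥ (hubbardTorusTT' L 1 t' U *ᵥ (curOpTT' L t' *ᵥ ψ))).re -
    fluxEnergyTT' L t' U δ 0 * (star (curOpTT' L t' *ᵥ ψ) ⬝ᵥ (curOpTT' L t' *ᵥ ψ)).re with hm₁
  set m₃ := (star ((hubbardTorusTT' L 1 t' U * curOpTT' L t' - curOpTT' L t' * hubbardTorusTT' L 1 t' U) *ᵥ ψ) ⬝ᵥ
        (hubbardTorusTT' L 1 t' U *ᵥ
          ((hubbardTorusTT' L 1 t' U * curOpTT' L t' - curOpTT' L t' * hubbardTorusTT' L 1 t' U) *ᵥ ψ))).re -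
      fluxEnergyTT' L t' U δ 0 *
        (star ((hubbardTorusTT' L 1 t' U * curOpTT' L t' - curOpTT' L t' * hubbardTorusTT' L 1 t' U) *ᵥ ψ) ⬝ᵥ
          ((hubbardTorusTT' L 1 t' U * curOpTT' L t' - curOpTT' L t' * hubbardTorusTT' L 1 t' U) *ᵥ ψ)).re
    with hm₃
  have hη : (hubbardTorusTT' L 1 t' U * curOpTT' L t' - curOpTT' L t' * hubbardTorusTT' L 1 t' U) *ᵥ ψ ∈
      szSector (2 * ⌊(1 - δ) * (L : ℝ) ^ 2 / 2⌋₊) 0 := by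
    rw [sub_mulVec, ← mulVec_mulVec, ← mulVec_mulVec]
    exact Submodule.sub_mem _
      (hubbardTorusTT'_mulVec_mem_szSector 1 t' U (curOpTT'_mulVec_mem_szSector t' hgs.1))
      (curOpTT'_mulVec_mem_szSector t' (hubbardTorusTT'_mulVec_mem_szSector 1 t' U hgs.1))
  have h := stiffnessTT'_mul_sq_le_of_isGroundStateInSector hL t' U δ hθ₀ hstiff hgs h1 hη (-m₁ / m₃)
  have hE : hubbardTorusTT' L 1 t' U *ᵥ ψ = ((fluxEnergyTT' L t' U δ 0 : ℝ) : ℂ) • ψ := by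
    rw [fluxEnergyTT'_eq, hubbardTorusTT'Flux_zero]
    exact hgs.2.2
  have hov : (star ψ ⬝ᵥ (curOpTT' L t' *ᵥ
      ((hubbardTorusTT' L 1 t' U * curOpTT' L t' - curOpTT' L t' * hubbardTorusTT' L 1 t' U) *ᵥ ψ))).re =
      m₁ := by
    rw [star_dotProduct_mulVec_commutator_mulVec (isHermitian_curOpTT' (L := L) t') hE, hm₁]
    simp only [Complex.sub_re, Complex.mul_re, Complex.ofReal_re, Complex.ofReal_im, zero_mul, sub_zero]
  rw [hov] at h
  have e : 2 * (-m₁ / m₃) * m₁ + (-m₁ / m₃) ^ 2 * m₃ = -(m₁ ^ 2 / m₃) := by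
    field_simp
    ring
  linarith

/-- **Certified-row form of the odd-moment ceiling**: certified bounds `½Re⟨ψ,𝒦ψ⟩ ≤ K_hi`,
`m₁ ≥ M1_lo ≥ 0`, `m₃ ≤ M3_hi` with `M3_hi > 0` (notation of
`stiffnessTT'_mul_sq_le_kinetic_sub_firstMoment_sq_div_thirdMoment`) give `ρ L² ≤ K_hi − M1_lo²/M3_hi`
(`λ = −M1_lo/M3_hi`). All three are linear certificates on expectations of translation sums of local
polynomials, hence thermodynamic-limit window-SDP rows. [cite: Lipparini2008, eq. (8.30)] -/
theorem stiffnessTT'_mul_sq_le_of_certified_odd_moments (hL : 3 ≤ L) (t' U δ : ℝ)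
    {ρs θ₀ : ℝ} (hθ₀ : 0 < θ₀)
    (hstiff : ∀ θ : ℝ, |θ| ≤ θ₀ →
      ρs * θ ^ 2 ≤ fluxEnergyTT' L t' U δ θ - fluxEnergyTT' L t' U δ 0)
    {ψ : Fock (Orb (FermionTorus 2 L))}
    (hgs : IsGroundStateInSector (hubbardTorusTT' L 1 t' U) (2 * ⌊(1 - δ) * (L : ℝ) ^ 2 / 2⌋₊) 0 ψ)
    (h1 : star ψ ⬝ᵥ ψ = 1) {Khi M1lo M3hi : ℝ}
    (hK : (star ψ ⬝ᵥ (kinOpTT' L t' *ᵥ ψ)).re / 2 ≤ Khi)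
    (hM1 : M1lo ≤ (star (curOpTT' L t' *ᵥ ψ) ⬝ᵥ (hubbardTorusTT' L 1 t' U *ᵥ (curOpTT' L t' *ᵥ ψ))).re -
        fluxEnergyTT' L t' U δ 0 * (star (curOpTT' L t' *ᵥ ψ) ⬝ᵥ (curOpTT' L t' *ᵥ ψ)).re)
    (hM1nn : 0 ≤ M1lo)
    (hM3 : (star ((hubbardTorusTT' L 1 t' U * curOpTT' L t' - curOpTT' L t' * hubbardTorusTT' L 1 t' U) *ᵥ ψ) ⬝ᵥ
        (hubbardTorusTT' L 1 t' U *ᵥ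
          ((hubbardTorusTT' L 1 t' U * curOpTT' L t' - curOpTT' L t' * hubbardTorusTT' L 1 t' U) *ᵥ ψ))).re -
      fluxEnergyTT' L t' U δ 0 *
        (star ((hubbardTorusTT' L 1 t' U * curOpTT' L t' - curOpTT' L t' * hubbardTorusTT' L 1 t' U) *ᵥ ψ) ⬝ᵥ
          ((hubbardTorusTT' L 1 t' U * curOpTT' L t' - curOpTT' L t' * hubbardTorusTT' L 1 t' U) *ᵥ ψ)).re ≤ M3hi)
    (hM3pos : 0 < M3hi) :
    ρs * (L : ℝ) ^ 2 ≤ Khi - M1lo ^ 2 / M3hi := by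
  set m₁ := (star (curOpTT' L t' *ᵥ ψ) ⬝ᵥ (hubbardTorusTT' L 1 t' U *ᵥ (curOpTT' L t' *ᵥ ψ))).re -
    fluxEnergyTT' L t' U δ 0 * (star (curOpTT' L t' *ᵥ ψ) ⬝ᵥ (curOpTT' L t' *ᵥ ψ)).re with hm₁
  set m₃ := (star ((hubbardTorusTT' L 1 t' U * curOpTT' L t' - curOpTT' L t' * hubbardTorusTT' L 1 t' U) *ᵥ ψ) ⬝ᵥ
        (hubbardTorusTT' L 1 t' U *ᵥ
          ((hubbardTorusTT' L 1 t' U * curOpTT' L t' - curOpTT' L t' * hubbardTorusTT' L 1 t' U) *ᵥ ψ))).re -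
      fluxEnergyTT' L t' U δ 0 *
        (star ((hubbardTorusTT' L 1 t' U * curOpTT' L t' - curOpTT' L t' * hubbardTorusTT' L 1 t' U) *ᵥ ψ) ⬝ᵥ
          ((hubbardTorusTT' L 1 t' U * curOpTT' L t' - curOpTT' L t' * hubbardTorusTT' L 1 t' U) *ᵥ ψ)).re
    with hm₃
  have hη : (hubbardTorusTT' L 1 t' U * curOpTT' L t' - curOpTT' L t' * hubbardTorusTT' L 1 t' U) *ᵥ ψ ∈
      szSector (2 * ⌊(1 - δ) * (L : ℝ) ^ 2 / 2⌋₊) 0 := by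
    rw [sub_mulVec, ← mulVec_mulVec, ← mulVec_mulVec]
    exact Submodule.sub_mem _
      (hubbardTorusTT'_mulVec_mem_szSector 1 t' U (curOpTT'_mulVec_mem_szSector t' hgs.1))
      (curOpTT'_mulVec_mem_szSector t' (hubbardTorusTT'_mulVec_mem_szSector 1 t' U hgs.1))
  have h := stiffnessTT'_mul_sq_le_of_isGroundStateInSector hL t' U δ hθ₀ hstiff hgs h1 hη (-M1lo / M3hi)
  have hE : hubbardTorusTT' L 1 t' U *ᵥ ψ = ((fluxEnergyTT' L t' U δ 0 : ℝ) : ℂ) • ψ := by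
    rw [fluxEnergyTT'_eq, hubbardTorusTT'Flux_zero]
    exact hgs.2.2
  have hov : (star ψ ⬝ᵥ (curOpTT' L t' *ᵥ
      ((hubbardTorusTT' L 1 t' U * curOpTT' L t' - curOpTT' L t' * hubbardTorusTT' L 1 t' U) *ᵥ ψ))).re =
      m₁ := by
    rw [star_dotProduct_mulVec_commutator_mulVec (isHermitian_curOpTT' (L := L) t') hE, hm₁]
    simp only [Complex.sub_re, Complex.mul_re, Complex.ofReal_re, Complex.ofReal_im, zero_mul, sub_zero]
  rw [hov] at h
  have hlam : 2 * (-M1lo / M3hi) ≤ 0 := by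
    have : 0 ≤ M1lo / M3hi := div_nonneg hM1nn hM3pos.le
    rw [neg_div]
    linarith
  have hA := mul_le_mul_of_nonpos_left hM1 hlam
  have hB' := mul_le_mul_of_nonneg_left hM3 (sq_nonneg (-M1lo / M3hi))
  have e : 2 * (-M1lo / M3hi) * M1lo + (-M1lo / M3hi) ^ 2 * M3hi = -(M1lo ^ 2 / M3hi) := by
    field_simp
    ring
  linarith

/-- **`m₃` as a double commutator** (the SDP objective): for a zero-flux `(N, M)`-sector ground state
`ψ` and `B = H𝒥 − 𝒥H` (`𝒥 = curOpTT'`, `H = hubbardTorusTT' L 1 t' U`, `E₀` the sector energy),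
`Re⟨Bψ, H Bψ⟩ − E₀‖Bψ‖² = −½ Re⟨ψ, (B(HB − BH) − (HB − BH)B) ψ⟩` — the third moment of the current
strength function is the expectation of ONE Hermitian fermion polynomial (a translation sum of local
terms: commutators of local sums are local sums). [cite: Lipparini2008, eq. (8.30)] -/
theorem curOpTT'_thirdMoment_eq_re_doubleCommutator (t' U : ℝ) {N : ℕ} {M : ℝ}
    {ψ : Fock (Orb (FermionTorus 2 L))} (hgs : IsGroundStateInSector (hubbardTorusTT' L 1 t' U) N M ψ) :
    (star ((hubbardTorusTT' L 1 t' U * curOpTT' L t' - curOpTT' L t' * hubbardTorusTT' L 1 t' U) *ᵥ ψ) ⬝ᵥ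
        (hubbardTorusTT' L 1 t' U *ᵥ
          ((hubbardTorusTT' L 1 t' U * curOpTT' L t' - curOpTT' L t' * hubbardTorusTT' L 1 t' U) *ᵥ ψ))).re -
      (hubbardTorusTT' L 1 t' U).minEnergyOn (szSector N M) *
        (star ((hubbardTorusTT' L 1 t' U * curOpTT' L t' - curOpTT' L t' * hubbardTorusTT' L 1 t' U) *ᵥ ψ) ⬝ᵥ
          ((hubbardTorusTT' L 1 t' U * curOpTT' L t' - curOpTT' L t' * hubbardTorusTT' L 1 t' U) *ᵥ ψ)).re =
      -((star ψ ⬝ᵥ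
        (((hubbardTorusTT' L 1 t' U * curOpTT' L t' - curOpTT' L t' * hubbardTorusTT' L 1 t' U) *
            (hubbardTorusTT' L 1 t' U *
                (hubbardTorusTT' L 1 t' U * curOpTT' L t' - curOpTT' L t' * hubbardTorusTT' L 1 t' U) -
              (hubbardTorusTT' L 1 t' U * curOpTT' L t' - curOpTT' L t' * hubbardTorusTT' L 1 t' U) *
                hubbardTorusTT' L 1 t' U) -
          (hubbardTorusTT' L 1 t' U *
              (hubbardTorusTT' L 1 t' U * curOpTT' L t' - curOpTT' L t' * hubbardTorusTT' L 1 t' U) -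
            (hubbardTorusTT' L 1 t' U * curOpTT' L t' - curOpTT' L t' * hubbardTorusTT' L 1 t' U) *
              hubbardTorusTT' L 1 t' U) *
            (hubbardTorusTT' L 1 t' U * curOpTT' L t' - curOpTT' L t' * hubbardTorusTT' L 1 t' U)) *ᵥ
          ψ)).re / 2) := by
  set H := hubbardTorusTT' L 1 t' U with hHdef
  set J := curOpTT' L t' with hJdef
  set B := H * J - J * H with hBdef
  obtain ⟨-, -, hHψ⟩ := hgs
  have hB : Bᴴ = -B :=
    conjTranspose_commutator_of_isHermitian (hubbardTorusTT'_isHermitian L 1 t' U)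
      (isHermitian_curOpTT' (L := L) t')
  rw [star_dotProduct_doubleCommutator_mulVec_of_conjTranspose_eq_neg
    (hubbardTorusTT'_isHermitian L 1 t' U) hB hHψ]
  have hreal : (star (B *ᵥ ψ) ⬝ᵥ (B *ᵥ ψ)).im = 0 := by
    rw [RayleighBottom.star_dotProduct_self_eq_sum, Complex.ofReal_im]
  simp only [Complex.add_re, Complex.neg_re, Complex.mul_re, Complex.re_ofNat,
    Complex.im_ofNat, Complex.ofReal_re, Complex.ofReal_im, hreal, zero_mul, sub_zero, mul_zero]
  ring

end Literature.MathematicalPhysics.QuantumLattice
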